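import Summits.BirchSwinnertonDyer.Rank1Residual.X11b.WeakLeopoldt
import Literature.NumberTheory.EllipticCurves.IwasawaCoinvariantsRankProofs
import HarnessLib

/-!
# Crux `PrintCf2.SplitBadTwoRankOneOfFacts` (stmt-BirchSwinnertonDyer-20368), road α v10.3, S3c residual (R-TOP) = brick B17, input (α):
# WEAK LEOPOLDT `H²(Γ_K, E[p^∞]) = 0` WITHOUT «`E[p^∞]^{Γ_K} = 0`» AND WITHOUT Castella finiteness — from the finiteness of `Ш¹(K, E[p^∞])`

Cell `bsd-print-cf2`, EXTRA WIDTH seat `bsd-line-cf2-p1-w4` g9 (prover-bsd-line-cf2-p1-w4-g9-0); `--supports stmt-BirchSwinnertonDyer-20368`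
(helper, Theses-free). HONEST FRAMING: nothing here closes the crux or a registered stub; BSD is not proved by any of this; no summit statement
is proved by this seat. No definition, no named fact, no `sorry`. CONDITIONAL on the two cited facts the X11b template already takes as
hypotheses: `poitouTate_sha_tateDual K` (Harari Thm. 17.13 (b) / Milne I 4.10 (a)) and `FieldCdLE K p 2` (Serre II §4.4 Prop. 13).

WHY. The (R-TOP) residual `#𝔖_Γ = 1` of LEAD g12's `restrictedControl_two_of_residuals` (p664178) is, by -w4 g8's p663870
(`noFiniteSubmodule_of_frame_of_subsingleton_H2_of_baseLift`) + LEAD's p657357, reduced to (α) `H²(Γ_K, W*) = 0` and (β) the base lift. For (α)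
the tree's template is `X11b.WeakLeopoldt.subsingleton_galoisCohomology_two_primary` (JSW17 Lemma 3.3.3 first half at the level of `H²`),
whose two arithmetic hypotheses BOTH FAIL for the members `cm7^{(d)}` over `K = ℚ(√−7)`: «`E[p^∞]^{Γ_K} = 0`» (`W[2] ⊂ W(K)`) and
«`Sel_𝔭(K, E[p^∞])` finite» (each CM summand has `𝒪`-corank one in one of Castella's two groups at analytic rank one). This file removes
both: the ONLY global input is a UNIFORM BOUND on `#Ш¹(K, E[p^k])`, `k ≥ 1`, which holds as soon as `Ш¹(K, E[p^∞])` (everywhere locally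
trivial classes) is finite — the kernel of `H¹(ι_k) : H¹(K, E[p^k]) → H¹(K, E[p^∞])` being the connecting image of the FINITE group
`E(K)[p^∞]` (Mordell–Weil torsion, tree `finite_fixedPoints_geomPrimaryTorsion`), not zero.

CONTENT (all `K` a number field, `W/K` elliptic, `p` prime).
* §1 `connectingClass_eq_of_nsmul_eq` — the connecting class `δ(b)` of `0 → A → B →[n] B → 0` depends only on `n • b` (generic level
  cohomology, `X11b.Levels`); `finite_sha_torsion_and_natCard_le` — **`#Ш¹(K, E[p^k]) ≤ #E[p^∞]^{Γ_K} · #Ш¹(K, E[p^∞])`** and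
  `Ш¹(K, E[p^k])` finite whenever `Ш¹(K, E[p^∞])` is.
* §2 `natCard_shaTwo_torsion_le_of_shaBound` — `#Ш²(K, E[p^k]) ≤ B` from `#Ш¹(K, E[p^k]) ≤ B` (PT for `Ш`, Weil transport; X11b.ShaBound
  §§1–2 verbatim); **`finite_galoisCohomology_two_primary_of_shaBound`**, **`subsingleton_galoisCohomology_two_primary_of_shaBound`** —
  X11b.WeakLeopoldt §3 with the bound `B` in place of `#Sel_𝔭(K, E[p^∞])` (`K` totally complex; local exponents `htor`; the two facts).
* §3 **`subsingleton_galoisCohomology_two_primary_of_finite_sha`** — `Ш¹(K, E[p^∞])` finite ⟹ `H²(Γ_K, E[p^∞]) = 0`.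
Successor file (this seat): `Ш¹(K, W_K[2^∞]) ↪ 𝔖_{v̄}(K, W*) × 𝔖_v(K, W*')` on the S3c frame by -w7 g2's eigen-projector, and the summand
transport `H²(Γ_K, W*) ↪ H²(Γ_K, E[2^∞])`.
presearch: JSW17 Lemma 3.3.3 (arXiv:1512.06894 pp. 11–12) [corpus, cited by the template]; Greenberg LNM 1716 §5 proof of Prop. 5.8 (kernel of
`H¹(ι_k)`); Milne ADT I 4.10 — no new fact (queries as in X11b.WeakLeopoldt; corpus+galaxy not re-run: template port). beyond-print theorem: no.

References: [JetchevSkinnerWan2017] Lemma 3.3.3; [GreenbergLNM1716] §3 Lemma 3.1, §5 proof of Prop. 5.8; [Harari2020] Thm. 17.13 (b);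
[SerreGaloisCohomology1997] II §4.4 Prop. 13; [MilneADT2006] I Thm. 4.10 (a), Lemma 4.8.
-/

noncomputable section

open scoped Classical

set_option linter.dupNamespace false
set_option autoImplicit false

open CategoryTheory Field NumberField IsDedekindDomain
open Literature.NumberTheory.EllipticCurves
open Literature.NumberTheory.GaloisRepresentations
open Literature.NumberTheory.GaloisRepresentations.DiscreteGaloisModule
open Literature.NumberTheory.GaloisCohomology
open scoped ContRepresentation
open Summit.BirchSwinnertonDyer.Rank1Residual.X11b

namespace Summit.BirchSwinnertonDyer.BirchSwinnertonDyer.Theorems.PrintCf2.WeakLeopoldt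

/-! ## §1. The kernel of `H¹(ι_k)` is the connecting image of the finite group `E(K)[p^∞]`: a uniform bound on `#Ш¹(K, E[p^k])` -/

section Connecting

variable {F : Type} [Field F] {A B : Type} [AddCommGroup A] [TopologicalSpace A]
  [DiscreteTopology A] [AddCommGroup B] [TopologicalSpace B] [DiscreteTopology B]
  {ρA : DiscreteGaloisModule F A} {ρB : DiscreteGaloisModule F B}
  {i : ρA.toContRepresentation →ⁱL ρB.toContRepresentation} {n : ℕ}
  {hrange : ∀ b : B, n • b = 0 → ∃ a : A, i a = b}

/-- **The connecting class `δ(b)` depends only on `n • b`**: if `n • b = n • b'` then `b − b' ∈ B[n] = i(A)`, say `= i a`, and the lifted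
coboundaries of `b`, `b'` differ by the coboundary of `a`. (The connecting HOMOMORPHISM `B^{Γ}/n → H¹(F, A)` of `0 → A → B →[n] B → 0`.)
[cite: GreenbergLNM1716, §5 proof of Prop. 5.8] -/
theorem connectingClass_eq_of_nsmul_eq (hinj : Function.Injective i) (b b' : B)
    (hb : ∀ σ : absoluteGaloisGroup F, ρB σ (n • b) = n • b) (hb' : ∀ σ : absoluteGaloisGroup F, ρB σ (n • b') = n • b')
    (h : n • b = n • b') :
    Levels.connectingClass i n hrange hinj b hb = Levels.connectingClass i n hrange hinj b' hb' := by
  obtain ⟨a, ha⟩ := hrange (b - b') (by rw [smul_sub, h, sub_self])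
  have key : oneCocycleClass ρA.toTopRep (Levels.liftCocycle i n hrange hinj (Levels.cobCocycle ρB b)
        (Levels.nsmul_cobCocycle_apply_eq_zero n hb)) -
      oneCocycleClass ρA.toTopRep (Levels.liftCocycle i n hrange hinj (Levels.cobCocycle ρB b')
        (Levels.nsmul_cobCocycle_apply_eq_zero n hb')) = 0 := by
    rw [← oneCocycleClass_sub, oneCocycleClass_eq_zero_iff]
    refine ⟨a, fun σ ↦ hinj ?_⟩
    have h' : i (ρA.toTopRep.ρ σ a) = ρB σ (i a) := i.isIntertwining σ a
    rw [Submodule.coe_sub, ContinuousMap.sub_apply, map_sub, Levels.apply_liftCocycle, Levels.apply_liftCocycle,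
      Levels.cobCocycle_apply, Levels.cobCocycle_apply, map_sub, h', ha, map_sub]
    abel
  exact sub_eq_zero.mp key

end Connecting

section ShaBound

variable {K : Type} [Field K] [NumberField K] (W : WeierstrassCurve K) [W.IsElliptic] (p : ℕ) [Fact p.Prime] (k : ℕ)

/-- **`Ш¹(K, E[p^k])` is finite and `#Ш¹(K, E[p^k]) ≤ #E[p^∞]^{Γ_K} · #Ш¹(K, E[p^∞])`** whenever `Ш¹(K, E[p^∞])` (the everywhere locally
trivial classes of `H¹(K, E[p^∞])`) is finite: `H¹(ι_k)` carries `Ш¹` into `Ш¹` (`ShaBound.map_mem_sha`) and its kernel on `Ш¹(K, E[p^k])`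
consists of connecting classes `δ(Q)`, `p^k Q ∈ E[p^∞]^{Γ_K}` (`Levels.map_primaryInclusion_eq_zero_iff`), each determined by `p^k Q`
(`connectingClass_eq_of_nsmul_eq`), and `E[p^∞]^{Γ_K} = E(K)[p^∞]` is finite (`finite_fixedPoints_geomPrimaryTorsion`). NO hypothesis
«`E[p^∞]^{Γ_K} = 0`». [cite: GreenbergLNM1716, §3 Lemma 3.1 and §5 proof of Prop. 5.8] -/
theorem finite_sha_torsion_and_natCard_le [Finite (sha (LocBridge.primaryGaloisModule W p))] :
    Finite (sha (W.torsionGaloisModule ((p ^ k : ℕ) : ℤ))) ∧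
      Nat.card (sha (W.torsionGaloisModule ((p ^ k : ℕ) : ℤ))) ≤
        Nat.card {m : W.geomPrimaryTorsion p // ∀ σ : absoluteGaloisGroup K, σ • m = m} *
          Nat.card (sha (LocBridge.primaryGaloisModule W p)) := by
  haveI : Finite {m : W.geomPrimaryTorsion p // ∀ σ : absoluteGaloisGroup K, σ • m = m} :=
    (W.finite_fixedPoints_geomPrimaryTorsion p).to_subtype
  -- `H¹(ι_k)` restricted to `Ш¹`
  let g : sha (W.torsionGaloisModule ((p ^ k : ℕ) : ℤ)) →+ sha (LocBridge.primaryGaloisModule W p) :=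
    ((galoisCohomology.map (Levels.primaryInclusion W p k) 1).comp (sha (W.torsionGaloisModule ((p ^ k : ℕ) : ℤ))).subtype).codRestrict
      (sha (LocBridge.primaryGaloisModule W p)) fun x ↦ ShaBound.map_mem_sha _ x.2
  -- the kernel injects into the fixed points
  have hker : ∀ c : g.ker, ∃ (Q : W.geomPrimaryTorsion p)
      (hQ : ∀ σ : absoluteGaloisGroup K, LocBridge.primaryGaloisModule W p σ (p ^ k • Q) = p ^ k • Q),
      ((c : sha (W.torsionGaloisModule ((p ^ k : ℕ) : ℤ))) : galoisCohomology (W.torsionGaloisModule ((p ^ k : ℕ) : ℤ)) 1) =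
        Levels.connectingClass (Levels.primaryInclusion W p k) (p ^ k) (Levels.exists_primaryInclusion_eq_of_nsmul_eq_zero W p k)
          (Levels.primaryInclusion_injective W p k) Q hQ := by
    intro c
    have hc : galoisCohomology.map (Levels.primaryInclusion W p k) 1
        ((c : sha (W.torsionGaloisModule ((p ^ k : ℕ) : ℤ))) : galoisCohomology (W.torsionGaloisModule ((p ^ k : ℕ) : ℤ)) 1) = 0 := by
      have h := c.2
      rw [AddMonoidHom.mem_ker] at h
      exact congrArg Subtype.val h
    exact (Levels.map_primaryInclusion_eq_zero_iff W p k _).mp hc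
  choose Q hQ hcQ using hker
  let f : g.ker → {m : W.geomPrimaryTorsion p // ∀ σ : absoluteGaloisGroup K, σ • m = m} := fun c ↦ ⟨p ^ k • Q c, hQ c⟩
  have hf : Function.Injective f := by
    intro c c' h
    have hval : p ^ k • Q c = p ^ k • Q c' := congrArg Subtype.val h
    apply Subtype.ext; apply Subtype.ext
    rw [hcQ c, hcQ c']
    exact connectingClass_eq_of_nsmul_eq (Levels.primaryInclusion_injective W p k) _ _ (hQ c) (hQ c') hval
  haveI hkfin : Finite g.ker := Finite.of_injective f hf
  have hkcard : Nat.card g.ker ≤ Nat.card {m : W.geomPrimaryTorsion p // ∀ σ : absoluteGaloisGroup K, σ • m = m} :=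
    Nat.card_le_card_of_injective f hf
  haveI hrfin : Finite g.range := inferInstance
  have hrcard : Nat.card g.range ≤ Nat.card (sha (LocBridge.primaryGaloisModule W p)) :=
    Nat.card_le_card_of_injective _ Subtype.val_injective
  -- `#Ш¹(K, E[p^k]) = #ker · #range`
  have hmul : Nat.card (sha (W.torsionGaloisModule ((p ^ k : ℕ) : ℤ))) = Nat.card g.range * Nat.card g.ker := by
    rw [AddSubgroup.card_eq_card_quotient_mul_card_addSubgroup g.ker, Nat.card_congr (QuotientAddGroup.quotientKerEquivRange g).toEquiv]
  have hfin : Finite (sha (W.torsionGaloisModule ((p ^ k : ℕ) : ℤ))) := by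
    apply Nat.finite_of_card_ne_zero
    rw [hmul]
    exact mul_ne_zero Nat.card_pos.ne' Nat.card_pos.ne'
  refine ⟨hfin, ?_⟩
  rw [hmul, mul_comm]
  exact Nat.mul_le_mul hkcard hrcard

end ShaBound

/-! ## §2. X11b.WeakLeopoldt §3 with a uniform bound on `#Ш¹(K, E[p^k])` in place of Castella finiteness and «no invariants» -/

section Main

variable {K : Type} [Field K] [NumberField K] (W : WeierstrassCurve K) [W.IsElliptic] (p : ℕ) [Fact p.Prime]

/-- **`#Ш²(K, E[p^k]) ≤ B` from `#Ш¹(K, E[p^k]) ≤ B`** (`k ≥ 1`): `#Ш²(K, E[p^k]) = #Ш¹(K, E[p^k]^D)` (the cited Poitou–Tate duality for `Ш`,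
`ShaBound.natCard_shaTwo_eq_natCard_sha_tateDual`) `≤ #Ш¹(K, E[p^k])` (Weil transport, `ShaBound.natCard_sha_tateDual_le`).
[cite: Harari2020, Thm. 17.13 (b)] [cite: MilneADT2006, I Thm. 4.10 (a)] -/
theorem natCard_shaTwo_torsion_le_of_shaBound (hPT : poitouTate_sha_tateDual K) {k : ℕ} (hk : k ≠ 0) {B : ℕ}
    (hfin : Finite (sha (W.torsionGaloisModule ((p ^ k : ℕ) : ℤ))))
    (hB : Nat.card (sha (W.torsionGaloisModule ((p ^ k : ℕ) : ℤ))) ≤ B) :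
    Finite (shaTwo (W.torsionGaloisModule ((p ^ k : ℕ) : ℤ))) ∧
      Nat.card (shaTwo (W.torsionGaloisModule ((p ^ k : ℕ) : ℤ))) ≤ B := by
  have hprime : p.Prime := Fact.out
  haveI : NeZero (p ^ k) := ⟨pow_ne_zero k hprime.ne_zero⟩
  haveI : NeZero ((p ^ k : ℕ) : ℤ) := ⟨by exact_mod_cast pow_ne_zero k hprime.ne_zero⟩
  haveI : Finite (W.geomTorsion ((p ^ k : ℕ) : ℤ)) := Literature.NumberTheory.EllipticCurves.finite_geomTorsion_of_neZero W (p ^ k)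
  haveI : CompactSpace (absoluteGaloisGroup K) := absoluteGaloisGroup_compactSpace K
  have h2 : 2 ≤ p ^ k :=
    le_trans hprime.two_le (by simpa using Nat.pow_le_pow_right hprime.pos (Nat.one_le_iff_ne_zero.2 hk))
  obtain ⟨hfin2, -, hcard⟩ := ShaBound.natCard_shaTwo_eq_natCard_sha_tateDual hPT (p ^ k)
    (W.torsionGaloisModule ((p ^ k : ℕ) : ℤ)) (fun T ↦ AddSubgroup.torsionBy.nsmul T)
  haveI := hfin
  exact ⟨hfin2, hcard ▸ (ShaBound.natCard_sha_tateDual_le W (p ^ k) h2).trans hB⟩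

/-- **`H²(Γ_K, E[p^∞])` is finite, of order at most `B`**, for `K` totally complex, granted a uniform bound `#Ш¹(K, E[p^k]) ≤ B` (`k ≥ 1`),
uniform local `p`-power exponents, and the cited Poitou–Tate fact: every finite set of classes lifts to a single `Ш²(K, E[p^M])`
(`WeakLeopoldt.exists_mem_shaTwo_map_eq`), whose order is at most `B`. X11b's `finite_galoisCohomology_two_primary` with the bound replacing
`#Sel_𝔭(K, E[p^∞])` — no «`E[p^∞]^{Γ_K} = 0`». [cite: JetchevSkinnerWan2017, Lemma 3.3.3 (arXiv:1512.06894 p. 12)] [cite: Harari2020, Thm. 17.13 (b)] -/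
theorem finite_galoisCohomology_two_primary_of_shaBound [IsTotallyComplex K] (hPT : poitouTate_sha_tateDual K) {B : ℕ}
    (hB : ∀ k : ℕ, k ≠ 0 → Finite (sha (W.torsionGaloisModule ((p ^ k : ℕ) : ℤ))) ∧
      Nat.card (sha (W.torsionGaloisModule ((p ^ k : ℕ) : ℤ))) ≤ B)
    (htor : ∀ v : HeightOneSpectrum (𝓞 K), ∃ e : ℕ,
      ∀ (j : ℕ) (Q : (W.baseChange (v.adicCompletion K)).toAffine.Point),
        p ^ j • Q = 0 → p ^ e • Q = 0) :
    Finite (galoisCohomology (LocBridge.primaryGaloisModule W p) 2) := by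
  have key : ∀ s : Finset (galoisCohomology (LocBridge.primaryGaloisModule W p) 2), s.card ≤ B := by
    intro s
    choose M hM0 z hzsha hz using fun Z : galoisCohomology (LocBridge.primaryGaloisModule W p) 2 ↦
      WeakLeopoldt.exists_mem_shaTwo_map_eq W p htor Z
    have hML : ∀ Z ∈ s, M Z ≤ s.sup M + 1 := fun Z hZ ↦ (Finset.le_sup hZ).trans (Nat.le_succ _)
    obtain ⟨hfin1, hcard1⟩ := hB (s.sup M + 1) (Nat.succ_ne_zero _)
    obtain ⟨hfinL, hcardL⟩ := natCard_shaTwo_torsion_le_of_shaBound W p hPT (Nat.succ_ne_zero _) hfin1 hcard1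
    haveI := hfinL
    haveI := Fintype.ofFinite (shaTwo (W.torsionGaloisModule ((p ^ (s.sup M + 1) : ℕ) : ℤ)))
    let g : shaTwo (W.torsionGaloisModule ((p ^ (s.sup M + 1) : ℕ) : ℤ)) →
        galoisCohomology (LocBridge.primaryGaloisModule W p) 2 :=
      fun y ↦ galoisCohomology.map (Levels.primaryInclusion W p (s.sup M + 1)) 2 y
    have hsub : s ⊆ Finset.univ.image g := by
      intro Z hZ
      rw [Finset.mem_image]
      refine ⟨⟨galoisCohomology.map (W.torsionInclusion (WeakLeopoldt.pow_dvd_pow_cast p (hML Z hZ))) 2 (z Z),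
        WeakLeopoldt.map_torsionInclusion_mem_shaTwo W p (hML Z hZ) (hzsha Z)⟩, Finset.mem_univ _, ?_⟩
      change galoisCohomology.map (Levels.primaryInclusion W p (s.sup M + 1)) 2
        (galoisCohomology.map (W.torsionInclusion (WeakLeopoldt.pow_dvd_pow_cast p (hML Z hZ))) 2 (z Z)) = Z
      rw [WeakLeopoldt.map_primaryInclusion_map_torsionInclusion W p (hML Z hZ), hz]
    calc s.card ≤ (Finset.univ.image g).card := Finset.card_le_card hsub
      _ ≤ Finset.univ.card := Finset.card_image_le
      _ = Nat.card (shaTwo (W.torsionGaloisModule ((p ^ (s.sup M + 1) : ℕ) : ℤ))) := by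
          rw [Finset.card_univ, Nat.card_eq_fintype_card]
      _ ≤ B := hcardL
  by_contra hinf
  rw [not_finite_iff_infinite] at hinf
  obtain ⟨t, -, ht⟩ :=
    (Set.infinite_univ (α := galoisCohomology (LocBridge.primaryGaloisModule W p) 2)).exists_subset_card_eq (B + 1)
  have := key t
  omega

/-- **WEAK LEOPOLDT `H²(Γ_K, E[p^∞]) = 0` over a totally complex number field from a UNIFORM BOUND on `#Ш¹(K, E[p^k])`** (plus uniform local
`p`-power exponents and the cited facts `poitouTate_sha_tateDual K`, `FieldCdLE K p 2`): finite (`finite_galoisCohomology_two_primary_of_shaBound`),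
`p`-primary (`WeakLeopoldt.exists_pow_smul_eq_zero`) and `p`-divisible (`WeakLeopoldt.exists_smul_eq`, `cd_p ≤ 2`), hence trivial. X11b's
`subsingleton_galoisCohomology_two_primary` WITHOUT «`E[p^∞]^{Γ_K} = 0`» and WITHOUT Castella finiteness.
[cite: JetchevSkinnerWan2017, Lemma 3.3.3 (arXiv:1512.06894 pp. 11–12)] [cite: SerreGaloisCohomology1997, II §4.4 Prop. 13] -/
theorem subsingleton_galoisCohomology_two_primary_of_shaBound [IsTotallyComplex K] (hPT : poitouTate_sha_tateDual K)
    (hcd : FieldCdLE K p 2) {B : ℕ}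
    (hB : ∀ k : ℕ, k ≠ 0 → Finite (sha (W.torsionGaloisModule ((p ^ k : ℕ) : ℤ))) ∧
      Nat.card (sha (W.torsionGaloisModule ((p ^ k : ℕ) : ℤ))) ≤ B)
    (htor : ∀ v : HeightOneSpectrum (𝓞 K), ∃ e : ℕ,
      ∀ (j : ℕ) (Q : (W.baseChange (v.adicCompletion K)).toAffine.Point),
        p ^ j • Q = 0 → p ^ e • Q = 0) :
    Subsingleton (galoisCohomology (LocBridge.primaryGaloisModule W p) 2) := by
  haveI := finite_galoisCohomology_two_primary_of_shaBound W p hPT hB htor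
  choose n hn using WeakLeopoldt.exists_pow_smul_eq_zero W p
  haveI := Fintype.ofFinite (galoisCohomology (LocBridge.primaryGaloisModule W p) 2)
  have hexp : ∀ Z : galoisCohomology (LocBridge.primaryGaloisModule W p) 2, p ^ (Finset.univ.sup n) • Z = 0 := fun Z ↦ by
    have hle : n Z ≤ Finset.univ.sup n := Finset.le_sup (Finset.mem_univ Z)
    rw [← Nat.sub_add_cancel hle, pow_add, mul_smul, hn, smul_zero]
  have hiter : ∀ (m : ℕ) (Z : galoisCohomology (LocBridge.primaryGaloisModule W p) 2),
      ∃ Y : galoisCohomology (LocBridge.primaryGaloisModule W p) 2, p ^ m • Y = Z := by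
    intro m
    induction m with
    | zero => exact fun Z ↦ ⟨Z, by rw [pow_zero, one_smul]⟩
    | succ m ih =>
      intro Z
      obtain ⟨Y, rfl⟩ := ih Z
      obtain ⟨Y', rfl⟩ := WeakLeopoldt.exists_smul_eq W p hcd Y
      exact ⟨Y', by rw [pow_succ, mul_smul]⟩
  refine ⟨fun Z Z' ↦ ?_⟩
  obtain ⟨Y, rfl⟩ := hiter (Finset.univ.sup n) Z
  obtain ⟨Y', rfl⟩ := hiter (Finset.univ.sup n) Z'
  rw [hexp, hexp]

/-! ## §3. `Ш¹(K, E[p^∞])` finite ⟹ `H²(Γ_K, E[p^∞]) = 0` -/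

/-- **WEAK LEOPOLDT from the finiteness of `Ш¹(K, E[p^∞])`**: over a totally complex number field `K`, if the everywhere locally trivial
classes `Ш¹(K, E[p^∞]) ≤ H¹(K, E[p^∞])` form a finite group (at an analytic-rank-one CM member: each summand's `Ш¹` lies in a FINITE
restricted Selmer group — successor file), and the local `p`-power torsion exponents are uniform, then `H²(Γ_K, E[p^∞]) = 0`, granted the
cited facts. Bound: `B = #E(K)[p^∞] · #Ш¹(K, E[p^∞])` (§1). This is hypothesis (α)'s ambient form for brick B17.
[cite: JetchevSkinnerWan2017, Lemma 3.3.3 (arXiv:1512.06894 pp. 11–12)] [cite: GreenbergLNM1716, §5 proof of Prop. 5.8] -/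
theorem subsingleton_galoisCohomology_two_primary_of_finite_sha [IsTotallyComplex K] (hPT : poitouTate_sha_tateDual K)
    (hcd : FieldCdLE K p 2) [Finite (sha (LocBridge.primaryGaloisModule W p))]
    (htor : ∀ v : HeightOneSpectrum (𝓞 K), ∃ e : ℕ,
      ∀ (j : ℕ) (Q : (W.baseChange (v.adicCompletion K)).toAffine.Point),
        p ^ j • Q = 0 → p ^ e • Q = 0) :
    Subsingleton (galoisCohomology (LocBridge.primaryGaloisModule W p) 2) :=
  subsingleton_galoisCohomology_two_primary_of_shaBound W p hPT hcd
    (fun k _ ↦ finite_sha_torsion_and_natCard_le W p k) htor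

end Main

end Summit.BirchSwinnertonDyer.BirchSwinnertonDyer.Theorems.PrintCf2.WeakLeopoldt

end
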